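import Mathlib
import Summits.QuantumFields.YangMills.Theorems.SelfNormalisedSkewness.Negative.SelfNormalisedSkewnessFalseOfMaxwellDominatedWindowScheme
import Literature.MathematicalPhysics.QuantumFieldTheory.CurvatureGaussianField
import Literature.MathematicalPhysics.QuantumLattice.LatticeScalarField
import Literature.Probability.LatticeModels.LatticeGreenGradient
import Literature.Probability.LatticeModels.ThermodynamicLimit
import Literature.Probability.Distributions.GaussianWickTheorem
import Summits.QuantumFields.YangMills.Theorems.WeakCouplingRatesCurvatureKernel

/-!
# BC5 rung (T3 witness), LATTICE layer, for `FiniteRankMirror.X₁ = FiniteRankMirrorFloor`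
# — the abelian lattice gauge theory at Gaussian coupling is an HONEST-MEASURE instance of X₁ with
# `J = 1`, `p = 0`

Tribunal-w seat `ym-mirror-bc5w-1` (g3, 2026-08-28) for item `stmt-QuantumFields-25679`
(route `route-QuantumFields-FiniteRankMirror`).  The judge's g41 record (`j-t3-note-g41.md`) accepted the
continuum free-Maxwell rung `Lines/rung.lean` (`freeMaxwell_finiteRankMirrorFloor`, J = 1, p = 0) as the
T3 witness and named two optional upgrades: (α) "the free `U(1)₄` / lattice-Maxwell instance of X₁ with an
honest lattice measure (the Wick step (ii) of the dictionary proved, not informal)", (β) "a forced `J ≥ 2`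
instance".  THIS FILE LANDS (α) and records why (β) is not exhibitable in any convergent model (§8).

**The model.**  `μM = curvatureGaussianField 4 1` (tree; Garban–Sepúlveda `dΓd*` covariance
`curvatureTwoPoint`, the `β → ∞` local law of the `√β`-rescaled plaquette variables of lattice gauge
theory — see the docstring of `curvatureCovKernel`): the abelian lattice gauge theory of `ℤ⁴` at fixed
Gaussian coupling, plaquette curvatures `Y_q = ω q 0`.  **Dictionary to the crux** (each crux symbol ↦ its
abelian-Gaussian counterpart, same shape):
* `torusE G r β L F` (Wilson measure of the torus of side `2L+1`, periodic lift) ↦ `∫ F dμM` (infinite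
  volume; `L` survives only as the probe cut-off `box 4 L`, verbatim the crux's `box 4 L`);
* `dens G r y V` (the curvature species at the six plaquettes based at `y`) ↦ `densA y ω = ∑_{q at y} Y_q²`;
* `cfgReflect V` (Osterwalder–Seiler site reflection `Θ`: spatial links carried along, temporal links
  reversed) ↦ `cfgReflA ω`: the induced map on plaquette 2-forms, `(Θ^*Y)_{(y;i,j)} = Y_{(ϑy;i,j)}`
  (`1 ≤ i < j`), `(Θ^*Y)_{(y;0,j)} = −Y_{(ϑy−e₀;0,j)}`, `ϑ(y₀,y⃗) = (−y₀,y⃗)` (`tref`, = tree `siteReflect`)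
  — exactly the plaquettes whose holonomies `cfgReflect U` reads (tree `reflectEdge`);
* the scheme `β ↦ a β → 0` ↦ the lattice spacing `a → 0` itself (the Gaussian measure does not depend on
  the coupling after rescaling; `latticeMaxwell_finiteRankMirrorFloor_scheme` restores the literal
  `∀ β ≥ β₅, Λ₅ ≤ a β · L` shape for ANY positive scheme `a β → 0`);
* the mirror functional `torusE((F∘Θ)·F) − torusE(F)²`, `F = ∑_{y ∈ box 4 L} v(a y)·dens y` ↦
  `MF a v L = ∫ probe(cfgReflA ω)·probe(ω) dμM − (∫ probe dμM)²`, `probe a v L ω = ∑_{y ∈ box 4 L} v(a y)·densA y ω`.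

**What is proved (no `sorry`).**
§2–§4  `E[probe∘cfgReflA] = E[probe]` (`integral_probe_cfgReflA`; every `E[Y_q²] = 1/2`,
`curvatureTwoPoint_self`), hence `MF = Cov(probe∘Θ, probe)` (`MF_eq_cov`); Isserlis/Wick for the squares,
`Cov(Y_p², Y_q²) = 2·curvatureTwoPoint p q²` (`cov_sq_sq`, from the tree's `GaussianWick.integral_prod_four`)
— THIS is step (ii) of the g0 dictionary, now a theorem — and the exact expansion
`MF a v L = ∑_{y,y' ∈ box 4 L} v(ay)v(ay') ∑_{q at y, q' at y'} 2·curvatureTwoPoint(Θq, q')²` (`MF_eq`), every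
term `≥ 0` for `v ≥ 0`.
§5–§7  the HYPERSCALING FLOOR (`latticeMaxwell_mirrorFloor`): for every window `ℓ` one bump `v = wfun ℓ`
(support in `{y₀ > 0} ∩ B̄(0,ℓ)`, `0 ≤ v ≤ 1`) and `a₀ = ℓ/(128R₀)` such that for ALL spacings `0 < a ≤ a₀`
and ALL cut-offs `L` with `ℓ ≤ aL`:  `MF a v L ≥ κL = 1/(8π⁴·16912⁴)`.  Mechanism: `N = ⌊ℓ/(64a)⌋`,
`X = ⌊ℓ/(2a)⌋ ∈ [32N,64N]`, `v ≡ 1` on the `(2N+1)⁴`-site box around `X e₀` (`probe_one`); a site `y` of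
that box and the reflection `ϑy'` of another are separated by `z = ϑy − y'` with `|z₀| ∈ [62N,130N]`,
`|z_k| ≤ 2N`, so `z` lies in the transverse cone of the parallel `(1,2)`-plaquette kernel, where the tree's
closed form (`WeakCouplingRates.curvatureTwoPoint_eq_curl_greenTensor`) and Lawler (1.37)
(`latticeGreen_second_diff_continuum`) give `curvatureTwoPoint ≥ 1/(4π²|z|⁴) ≥ 1/(4π²(16912N²)²)`
(`kernel_cone_lower`, `kernel_lower_mirror`); keeping only these `(2N+1)⁸` plaquette pairs,
`MF ≥ (2N+1)⁸ · 2/(16π⁴16912⁴N⁸) ≥ κL` — the `a`-powers cancel exactly, so `p = 0`.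
Hence **X₁'s block with `J = 1`, `p = 0`** in this model, both spacing-indexed
(`latticeMaxwell_finiteRankMirrorFloor`) and in the literal scheme-indexed shape of the crux
(`latticeMaxwell_finiteRankMirrorFloor_scheme`).
§8  (β): `exists_mode_of_sum_floor` — at each `(a, L)` a `J`-mode floor `κ` contains ONE mode carrying `κ/J`;
so `J ≥ 2` can be forced only if the index of that mode keeps rotating as `a → 0`, i.e. only if the single-mode
functionals `MF(a, v_j, L)` fail to converge while their sum stays bounded below.  In this (convergent, free)
model — and in any model with a scaling limit of `MF` — `J = 1` is therefore never beaten; a forced-`J ≥ 2`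
witness would have to be a NON-convergent lattice family, which is not a decided model.  Recorded, not claimed.
§9  separation from S (= `BalabanLadder.NT`): NT's clause (ii) three-point floor is FALSE in the free Maxwell
continuum limit of this very model (`freeAbelian_NT_clauseII_false`, tree `maxwellRing3_eq_zero`), while X₁'s
block holds here: a model deciding C's analogue TRUE and S's analogue FALSE (`latticeRung_separates`).

Parts §5 (kernel floor, verbatim) and §6 (bump, probe box; `cube L` renamed to the crux's `box 4 L`, the probe
box to `pbox`) are COPIED with attribution from the sibling seat's work file
`Cruxes/StaticSourceResponse/Lines/rung.lean` v3 (g2, commit 90623342ef7c) — crux work files are not importable.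

NOTHING HERE PROVES the Yang–Mills mass gap, `NT`, `FiniteRankMirrorFloor` itself (a statement about compact
SIMPLE `G` and Wilson's measure), or any item of the route: it is the free abelian model's instance of X₁'s block.
-/

open MeasureTheory ProbabilityTheory Filter
open scoped Real NNReal ENNReal Topology

noncomputable section

namespace Summit.QuantumFields.YangMills.Cruxes.FiniteRankMirrorFloor.LatticeRung

open Literature.Probability.LatticeModels Literature.MathematicalPhysics.QuantumLattice
  Literature.MathematicalPhysics.QuantumFieldTheory Literature.Probability.Distributions
open Summit.QuantumFields.YangMills.Theorems.SelfNormalisedSkewness.Negative (E4 e₀)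

/-! ## §1 The model: abelian curvature configurations, the Gaussian measure, densities, probe, reflection -/

/-- The lattice configuration space: `ℝ¹`-valued plaquette `2`-cochains of `ℤ⁴`. [folklore] -/
abbrev Cfg : Type := ZdPlaquette 4 → Fin 1 → ℝ

/-- The lattice Maxwell (curvature Gaussian) field of `ℤ⁴` (↦ the crux's Wilson measure / `torusE`). [folklore] -/
abbrev μM : Measure Cfg := curvatureGaussianField 4 1

theorem three_le_four : 3 ≤ 4 := by norm_num

instance isProbabilityMeasure_μM : IsProbabilityMeasure μM :=
  isProbabilityMeasure_curvatureGaussianField three_le_four 1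

/-- An oriented coordinate plane `i < j` of `ℤ⁴`. [folklore] -/
abbrev Plane : Type := {p : Fin 4 × Fin 4 // p.1 < p.2}

/-- The `(1,2)` coordinate plane (spacelike). -/
def P12 : Plane := ⟨((1 : Fin 4), (2 : Fin 4)), by decide⟩

/-- The six plaquettes based at the site `y`. [folklore] -/
def plaqAt (y : Site 4) : Finset (ZdPlaquette 4) :=
  (Finset.univ : Finset Plane).image fun ij => (y, ij)

theorem mem_plaqAt (y : Site 4) : (y, P12) ∈ plaqAt y :=
  Finset.mem_image.mpr ⟨P12, Finset.mem_univ _, rfl⟩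

/-- The abelian plaquette energy density at `y`: `∑_{q at y} Y_q²` (↦ the crux's `dens G r y`). [folklore] -/
def densA (y : Site 4) (ω : Cfg) : ℝ := ∑ q ∈ plaqAt y, ω q 0 ^ 2

/-- The probe `∑_{y ∈ box 4 L} v(a y) · densA y` at spacing `a` with the crux's volume cut-off `box 4 L`
(↦ the crux's `fun V => ∑ y ∈ box 4 L, v j (a β • siteToE y) * dens G r y V`). [this route] -/
def probe (a : ℝ) (v : E4 → ℝ) (L : ℕ) (ω : Cfg) : ℝ :=
  ∑ y ∈ box 4 L, v (a • siteToE y) * densA y ω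

/-- Site reflection in time `ϑ(y₀, y⃗) = (−y₀, y⃗)` (same definition as the tree's `siteReflect`). [folklore] -/
def tref (y : Site 4) : Site 4 := Function.update y 0 (-y 0)

@[simp] theorem tref_apply_zero (y : Site 4) : tref y 0 = -y 0 := by simp [tref]

theorem tref_apply_of_ne (y : Site 4) {k : Fin 4} (hk : k ≠ 0) : tref y k = y k := by
  simp [tref, hk]

/-- The plaquette read by the reflected configuration at `q = (y; i<j)`: `(ϑy; i, j)` if spacelike,
`(ϑy − e₀; 0, j)` if timelike (the plaquettes of the tree's `reflectEdge`/`cfgReflect`). [folklore] -/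
def reflPlaq (q : ZdPlaquette 4) : ZdPlaquette 4 :=
  (if q.2.1.1 = 0 then tref q.1 - Pi.single 0 1 else tref q.1, q.2)

/-- Orientation sign of the pulled-back 2-form: `F_{0j} ↦ −F_{0j}∘ϑ`, `F_{ij} ↦ F_{ij}∘ϑ`. [folklore] -/
def reflSign (q : ZdPlaquette 4) : ℝ := if q.2.1.1 = 0 then -1 else 1

theorem reflSign_sq (q : ZdPlaquette 4) : reflSign q ^ 2 = 1 := by
  unfold reflSign; split_ifs <;> norm_num

/-- **The reflection `Θ` on abelian curvature configurations** (↦ the crux's `cfgReflect`). [folklore] -/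
def cfgReflA (ω : Cfg) : Cfg := fun q c => reflSign q * ω (reflPlaq q) c

theorem reflPlaq_P12 (y : Site 4) : reflPlaq (y, P12) = (tref y, P12) := by
  simp [reflPlaq, P12]

/-- The reflected density `∑_{q at y} Y_{Θq}²`. -/
def densR (y : Site 4) (ω : Cfg) : ℝ := ∑ q ∈ plaqAt y, ω (reflPlaq q) 0 ^ 2

/-- The reflected probe. -/
def probeR (a : ℝ) (v : E4 → ℝ) (L : ℕ) (ω : Cfg) : ℝ :=
  ∑ y ∈ box 4 L, v (a • siteToE y) * densR y ω

theorem densA_cfgReflA (y : Site 4) (ω : Cfg) : densA y (cfgReflA ω) = densR y ω := by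
  simp only [densA, densR, cfgReflA]
  refine Finset.sum_congr rfl fun q _ => ?_
  rw [mul_pow, reflSign_sq, one_mul]

theorem probe_cfgReflA (a : ℝ) (v : E4 → ℝ) (L : ℕ) (ω : Cfg) :
    probe a v L (cfgReflA ω) = probeR a v L ω := by
  simp only [probe, probeR, densA_cfgReflA]

/-- **The mirror functional of the crux in this model**: `torusE((F∘Θ)·F) − torusE(F)²` ↦
`∫ probe(Θω)·probe(ω) dμM − (∫ probe dμM)²`. [this route] -/
def MF (a : ℝ) (v : E4 → ℝ) (L : ℕ) : ℝ :=
  (∫ ω, probe a v L (cfgReflA ω) * probe a v L ω ∂μM) - (∫ ω, probe a v L ω ∂μM) ^ 2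

/-- the `(y, y')` term of the expanded mirror functional -/
def mterm (a : ℝ) (v : E4 → ℝ) (y y' : Site 4) : ℝ :=
  v (a • siteToE y) * v (a • siteToE y') *
    ∑ q ∈ plaqAt y, ∑ q' ∈ plaqAt y', 2 * curvatureTwoPoint (reflPlaq q) q' ^ 2

/-! ## §2 Gaussian facts of the tree's curvature field: centred, covariance `curvatureTwoPoint`, moments -/

theorem isGaussianProcess_eval : IsGaussianProcess
    (fun (s : ZdPlaquette 4 × Fin 1) (ω : Cfg) => ω s.1 s.2) μM :=
  isGaussianProcess_eval_curvatureGaussianField three_le_four 1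

theorem measurable_eval (q : ZdPlaquette 4) : Measurable fun ω : Cfg => ω q 0 :=
  (measurable_pi_apply 0).comp (measurable_pi_apply q)

theorem memLp_eval (p : ZdPlaquette 4) : MemLp (fun ω : Cfg => ω p 0) 2 μM :=
  (isGaussianProcess_eval.hasGaussianLaw_eval (p, 0)).memLp_two

theorem integral_eval (p : ZdPlaquette 4) : ∫ ω, ω p 0 ∂μM = 0 :=
  integral_eval_curvatureGaussianField three_le_four 1 p 0

theorem integral_eval' (t : ZdPlaquette 4 × Fin 1) : ∫ ω : Cfg, ω t.1 t.2 ∂μM = 0 :=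
  integral_eval_curvatureGaussianField three_le_four 1 t.1 t.2

/-- `E[Y_p Y_q] = curvatureTwoPoint p q`. [folklore] -/
theorem integral_mul_eval (p q : ZdPlaquette 4) :
    ∫ ω, ω p 0 * ω q 0 ∂μM = curvatureTwoPoint p q := by
  have h := covariance_eval_curvatureGaussianField three_le_four 1 p q 0 0
  rw [if_pos rfl, covariance_eq_sub (memLp_eval p) (memLp_eval q), integral_eval, integral_eval,
    mul_zero, sub_zero] at h
  simpa only [Pi.mul_apply] using h

/-- `E[Y_q²] = 1/2` for EVERY plaquette (equipartition; `curvatureTwoPoint_self`). [folklore] -/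
theorem integral_sq_eval (q : ZdPlaquette 4) : ∫ ω, ω q 0 ^ 2 ∂μM = 1 / 2 := by
  have h := integral_mul_eval q q
  rw [curvatureTwoPoint_self three_le_four] at h
  have e : ∫ ω, ω q 0 ^ 2 ∂μM = ∫ ω, ω q 0 * ω q 0 ∂μM :=
    integral_congr_ae (ae_of_all _ fun ω => by simp [sq])
  rw [e, h]
  norm_num

theorem integrable_pow_four (q : ZdPlaquette 4) : Integrable (fun ω : Cfg => ω q 0 ^ 4) μM := by
  have h := GaussianWick.integrable_pow_mul_prod isGaussianProcess_eval (q, (0 : Fin 1)) 4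
    (∅ : Finset (Fin 1)) (fun _ => (q, (0 : Fin 1)))
  simpa using h

theorem memLp_two_sq (q : ZdPlaquette 4) : MemLp (fun ω : Cfg => ω q 0 ^ 2) 2 μM := by
  refine (memLp_two_iff_integrable_sq ((measurable_eval q).pow_const 2).aestronglyMeasurable).2 ?_
  have e : (fun ω : Cfg => (ω q 0 ^ 2) ^ 2) = fun ω => ω q 0 ^ 4 := by
    funext ω; ring
  rw [e]
  exact integrable_pow_four q

/-- **Isserlis / Wick for two squares**: `E[Y_p² Y_q²] = E[Y_p²]E[Y_q²] + 2 E[Y_pY_q]²`. [folklore] -/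
theorem integral_sq_mul_sq (p q : ZdPlaquette 4) :
    ∫ ω, ω p 0 ^ 2 * ω q 0 ^ 2 ∂μM = 1 / 2 * (1 / 2) + 2 * curvatureTwoPoint p q ^ 2 := by
  have h4 := GaussianWick.integral_prod_four isGaussianProcess_eval integral_eval'
    ![((p, 0) : ZdPlaquette 4 × Fin 1), (p, 0), (q, 0), (q, 0)]
  have e0 : (![((p, 0) : ZdPlaquette 4 × Fin 1), (p, 0), (q, 0), (q, 0)]) 0 = (p, 0) := rfl
  have e1 : (![((p, 0) : ZdPlaquette 4 × Fin 1), (p, 0), (q, 0), (q, 0)]) 1 = (p, 0) := rfl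
  have e2 : (![((p, 0) : ZdPlaquette 4 × Fin 1), (p, 0), (q, 0), (q, 0)]) 2 = (q, 0) := rfl
  have e3 : (![((p, 0) : ZdPlaquette 4 × Fin 1), (p, 0), (q, 0), (q, 0)]) 3 = (q, 0) := rfl
  simp only [e0, e1, e2, e3] at h4
  rw [integral_mul_eval p p, integral_mul_eval q q, integral_mul_eval p q,
    curvatureTwoPoint_self three_le_four p, curvatureTwoPoint_self three_le_four q] at h4
  have hl : ∀ ω : Cfg, ω p 0 ^ 2 * ω q 0 ^ 2 = ω p 0 * ω p 0 * ω q 0 * ω q 0 := fun ω => by ring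
  simp_rw [hl, h4]
  push_cast
  ring

/-- **`Cov(Y_p², Y_q²) = 2·curvatureTwoPoint p q²`** — step (ii) of the dictionary, now a theorem. [folklore] -/
theorem cov_sq_sq (p q : ZdPlaquette 4) :
    cov[fun ω : Cfg => ω p 0 ^ 2, fun ω : Cfg => ω q 0 ^ 2; μM] = 2 * curvatureTwoPoint p q ^ 2 := by
  rw [covariance_eq_sub (memLp_two_sq p) (memLp_two_sq q)]
  simp only [Pi.mul_apply]
  rw [integral_sq_mul_sq, integral_sq_eval, integral_sq_eval]
  ring

/-! ## §3 Expectations of the probe and of the reflected probe coincide -/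

theorem memLp_densA (y : Site 4) : MemLp (densA y) 2 μM := by
  show MemLp (fun ω : Cfg => ∑ q ∈ plaqAt y, ω q 0 ^ 2) 2 μM
  exact memLp_finsetSum _ fun q _ => memLp_two_sq q

theorem memLp_densR (y : Site 4) : MemLp (densR y) 2 μM := by
  show MemLp (fun ω : Cfg => ∑ q ∈ plaqAt y, ω (reflPlaq q) 0 ^ 2) 2 μM
  exact memLp_finsetSum _ fun q _ => memLp_two_sq (reflPlaq q)

theorem memLp_probe (a : ℝ) (v : E4 → ℝ) (L : ℕ) : MemLp (probe a v L) 2 μM := by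
  show MemLp (fun ω : Cfg => ∑ y ∈ box 4 L, v (a • siteToE y) * densA y ω) 2 μM
  exact memLp_finsetSum _ fun y _ => (memLp_densA y).const_mul _

theorem memLp_probeR (a : ℝ) (v : E4 → ℝ) (L : ℕ) : MemLp (probeR a v L) 2 μM := by
  show MemLp (fun ω : Cfg => ∑ y ∈ box 4 L, v (a • siteToE y) * densR y ω) 2 μM
  exact memLp_finsetSum _ fun y _ => (memLp_densR y).const_mul _

theorem integral_densA (y : Site 4) : ∫ ω, densA y ω ∂μM = ∑ _q ∈ plaqAt y, (1 / 2 : ℝ) := by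
  simp only [densA]
  rw [integral_finsetSum _ fun q _ => (memLp_two_sq q).integrable one_le_two]
  exact Finset.sum_congr rfl fun q _ => integral_sq_eval q

theorem integral_densR (y : Site 4) : ∫ ω, densR y ω ∂μM = ∑ _q ∈ plaqAt y, (1 / 2 : ℝ) := by
  simp only [densR]
  rw [integral_finsetSum _ fun q _ => (memLp_two_sq (reflPlaq q)).integrable one_le_two]
  exact Finset.sum_congr rfl fun q _ => integral_sq_eval (reflPlaq q)

theorem integral_probe (a : ℝ) (v : E4 → ℝ) (L : ℕ) :
    ∫ ω, probe a v L ω ∂μM = ∑ y ∈ box 4 L, v (a • siteToE y) * ∑ _q ∈ plaqAt y, (1 / 2 : ℝ) := by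
  simp only [probe]
  rw [integral_finsetSum _ fun y _ => ((memLp_densA y).integrable one_le_two).const_mul _]
  refine Finset.sum_congr rfl fun y _ => ?_
  rw [integral_const_mul, integral_densA]

theorem integral_probeR (a : ℝ) (v : E4 → ℝ) (L : ℕ) :
    ∫ ω, probeR a v L ω ∂μM = ∑ y ∈ box 4 L, v (a • siteToE y) * ∑ _q ∈ plaqAt y, (1 / 2 : ℝ) := by
  simp only [probeR]
  rw [integral_finsetSum _ fun y _ => ((memLp_densR y).integrable one_le_two).const_mul _]
  refine Finset.sum_congr rfl fun y _ => ?_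
  rw [integral_const_mul, integral_densR]

theorem integral_probeR_eq (a : ℝ) (v : E4 → ℝ) (L : ℕ) :
    ∫ ω, probeR a v L ω ∂μM = ∫ ω, probe a v L ω ∂μM := by
  rw [integral_probeR, integral_probe]

/-- **Reflection invariance of the probe's mean**: `E[probe ∘ Θ] = E[probe]` (every plaquette has the same
variance), so the crux's `− torusE(F)²` IS the covariance subtraction here too. [this route] -/
theorem integral_probe_cfgReflA (a : ℝ) (v : E4 → ℝ) (L : ℕ) :
    ∫ ω, probe a v L (cfgReflA ω) ∂μM = ∫ ω, probe a v L ω ∂μM := by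
  simp_rw [probe_cfgReflA]
  exact integral_probeR_eq a v L

/-! ## §4 The mirror functional is a covariance; its exact Wick expansion -/

theorem MF_eq_cov (a : ℝ) (v : E4 → ℝ) (L : ℕ) : MF a v L = cov[probeR a v L, probe a v L; μM] := by
  rw [covariance_eq_sub (memLp_probeR a v L) (memLp_probe a v L), MF]
  simp only [Pi.mul_apply, probe_cfgReflA]
  rw [integral_probeR_eq a v L, sq]

theorem cov_expand (a : ℝ) (v : E4 → ℝ) (L : ℕ) :
    cov[probeR a v L, probe a v L; μM] = ∑ y ∈ box 4 L, ∑ y' ∈ box 4 L, mterm a v y y' := by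
  have h1 : cov[probeR a v L, probe a v L; μM] =
      ∑ y ∈ box 4 L, ∑ y' ∈ box 4 L,
        cov[fun ω => v (a • siteToE y) * densR y ω, fun ω => v (a • siteToE y') * densA y' ω; μM] := by
    show cov[fun ω => ∑ y ∈ box 4 L, v (a • siteToE y) * densR y ω,
      fun ω => ∑ y' ∈ box 4 L, v (a • siteToE y') * densA y' ω; μM] = _
    exact covariance_fun_sum_fun_sum' (fun y _ => (memLp_densR y).const_mul _)
      (fun y' _ => (memLp_densA y').const_mul _)
  rw [h1]
  refine Finset.sum_congr rfl fun y _ => Finset.sum_congr rfl fun y' _ => ?_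
  rw [covariance_const_mul_left, covariance_const_mul_right, ← mul_assoc, mterm]
  congr 1
  show cov[fun ω : Cfg => ∑ q ∈ plaqAt y, ω (reflPlaq q) 0 ^ 2,
    fun ω : Cfg => ∑ q' ∈ plaqAt y', ω q' 0 ^ 2; μM] = _
  rw [covariance_fun_sum_fun_sum' (fun q _ => memLp_two_sq (reflPlaq q)) (fun q' _ => memLp_two_sq q')]
  exact Finset.sum_congr rfl fun q _ => Finset.sum_congr rfl fun q' _ => cov_sq_sq (reflPlaq q) q'

/-- **The Wick expansion of the mirror functional**:
`MF a v L = ∑_{y,y' ∈ box 4 L} v(ay) v(ay') ∑_{q at y} ∑_{q' at y'} 2·curvatureTwoPoint(Θq, q')²`. [this route] -/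
theorem MF_eq (a : ℝ) (v : E4 → ℝ) (L : ℕ) :
    MF a v L = ∑ y ∈ box 4 L, ∑ y' ∈ box 4 L, mterm a v y y' := by
  rw [MF_eq_cov, cov_expand]

theorem mterm_nonneg {a : ℝ} {v : E4 → ℝ} (hv : ∀ z, 0 ≤ v z) (y y' : Site 4) : 0 ≤ mterm a v y y' :=
  mul_nonneg (mul_nonneg (hv _) (hv _))
    (Finset.sum_nonneg fun _ _ => Finset.sum_nonneg fun _ _ => by positivity)

/-- Mirror positivity of the free model for nonnegative probes (termwise). [this route] -/
theorem MF_nonneg {a : ℝ} {v : E4 → ℝ} (hv : ∀ z, 0 ≤ v z) (L : ℕ) : 0 ≤ MF a v L := by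
  rw [MF_eq]
  exact Finset.sum_nonneg fun y _ => Finset.sum_nonneg fun y' _ => mterm_nonneg hv y y'

/-! ## §5 The parallel-plaquette kernel: closed form and far-field cone positivity
(COPIED from `Cruxes/StaticSourceResponse/Lines/rung.lean` v3, Part C, seat ym-mirror-bc5w-1 g2) -/

/-- squared Euclidean length of a site -/
def S (z : Site 4) : ℝ := ∑ j, ((z j : ℤ) : ℝ) ^ 2

theorem S_eq (z : Site 4) : S z = ((z 0 : ℤ) : ℝ) ^ 2 + ((z 1 : ℤ) : ℝ) ^ 2 + ((z 2 : ℤ) : ℝ) ^ 2 + ((z 3 : ℤ) : ℝ) ^ 2 := by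
  simp [S, Fin.sum_univ_four]

theorem S_nonneg (z : Site 4) : 0 ≤ S z := Finset.sum_nonneg fun _ _ => sq_nonneg _

/-- closed form: parallel `(1,2)` plaquettes -/
theorem curvatureTwoPoint_P12 (x y : Site 4) :
    curvatureTwoPoint (x, P12) (y, P12) =
      -((latticeGreen (x - y + Pi.single 1 1) + latticeGreen (x - y - Pi.single 1 1) - 2 * latticeGreen (x - y)) +
        (latticeGreen (x - y + Pi.single 2 1) + latticeGreen (x - y - Pi.single 2 1) - 2 * latticeGreen (x - y))) / 2 := by
  rw [Summit.QuantumFields.YangMills.Theorems.WeakCouplingRates.curvatureTwoPoint_eq_curl_greenTensor]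
  have h := Summit.QuantumFields.YangMills.Theorems.WeakCouplingRates.curl_greenTensor_parallel y x
    (by decide : (1 : Fin 4) ≠ 2)
  simp only [P12] at h ⊢
  rw [h]

/-- Lawler (1.37) at `d = 4` in the normalisation used here:
`|Δ_iG(z) + (1/π²)(1/S² - 4 zᵢ²/S³)| ≤ K/(S²√S)`, `S = |z|²`, all `z ≠ 0`. -/
theorem secondDiff_asymp : ∃ K : ℝ, 0 ≤ K ∧ ∀ z : Site 4, z ≠ 0 → ∀ i : Fin 4,
    |latticeGreen (z + Pi.single i 1) + latticeGreen (z - Pi.single i 1) - 2 * latticeGreen z +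
        (1 / π ^ 2) * (1 / S z ^ 2 - 4 * ((z i : ℤ) : ℝ) ^ 2 / S z ^ 3)| ≤ K / (S z ^ 2 * Real.sqrt (S z)) := by
  obtain ⟨K, hK0, hK⟩ := latticeGreen_second_diff_continuum (d := 4) (by norm_num)
  refine ⟨K, hK0, fun z hz i => ?_⟩
  have h := hK z hz i
  have hSpos : 0 < S z := by
    rcases Function.ne_iff.mp hz with ⟨j, hj⟩
    have hj' : ((z j : ℤ) : ℝ) ≠ 0 := by exact_mod_cast hj
    have : 0 < ((z j : ℤ) : ℝ) ^ 2 := by positivity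
    exact lt_of_lt_of_le this (Finset.single_le_sum (f := fun j => ((z j : ℤ) : ℝ) ^ 2)
      (fun _ _ => sq_nonneg _) (Finset.mem_univ j))
  have hs : Real.sqrt (∑ j, ((z j : ℤ) : ℝ) ^ 2) = Real.sqrt (S z) := rfl
  set r := Real.sqrt (S z) with hr
  have hrpos : 0 < r := Real.sqrt_pos.mpr hSpos
  have hr2 : r ^ 2 = S z := Real.sq_sqrt hSpos.le
  have ha : Real.Gamma (((4 : ℕ) : ℝ) / 2 - 1) / (2 * π ^ (((4 : ℕ) : ℝ) / 2)) = 1 / (2 * π ^ 2) := by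
    have h1 : (((4 : ℕ) : ℝ) / 2 - 1) = 1 := by norm_num
    have h2 : (((4 : ℕ) : ℝ) / 2) = ((2 : ℕ) : ℝ) := by norm_num
    rw [h1, h2, Real.Gamma_one, Real.rpow_natCast]
  have hpow4 : r ^ (-((4 : ℕ) : ℝ)) = 1 / S z ^ 2 := by
    rw [Real.rpow_neg hrpos.le, Real.rpow_natCast, one_div, ← hr2]; ring
  have hpow6 : r ^ (-(((4 : ℕ) : ℝ) + 2)) = 1 / S z ^ 3 := by
    rw [show (-(((4 : ℕ) : ℝ) + 2)) = -((6 : ℕ) : ℝ) by norm_num, Real.rpow_neg hrpos.le, Real.rpow_natCast,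
      one_div, ← hr2]; ring
  have hpow5 : r ^ (-(((4 : ℕ) : ℝ) + 1)) = 1 / (S z ^ 2 * r) := by
    rw [show (-(((4 : ℕ) : ℝ) + 1)) = -((5 : ℕ) : ℝ) by norm_num, Real.rpow_neg hrpos.le, Real.rpow_natCast,
      one_div, ← hr2]; ring
  rw [hs, ha, hpow4, hpow6, hpow5] at h
  have e4 : (2 - ((4 : ℕ) : ℝ)) = -2 := by norm_num
  rw [e4] at h
  have key : latticeGreen (z + Pi.single i 1) + latticeGreen (z - Pi.single i 1) - 2 * latticeGreen z +
        1 / π ^ 2 * (1 / S z ^ 2 - 4 * ((z i : ℤ) : ℝ) ^ 2 / S z ^ 3) =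
      latticeGreen (z + Pi.single i 1) + latticeGreen (z - Pi.single i 1) - 2 * latticeGreen z -
        1 / (2 * π ^ 2) * (-2 * (1 / S z ^ 2 - (4 : ℕ) * ((z i : ℤ) : ℝ) ^ 2 * (1 / S z ^ 3))) := by
    push_cast; ring
  rw [key]
  have e5 : K * (1 / (S z ^ 2 * r)) = K / (S z ^ 2 * r) := by ring
  rw [e5] at h
  exact h

theorem S_pos_of_ne {z : Site 4} (hz : z ≠ 0) : 0 < S z := by
  rcases Function.ne_iff.mp hz with ⟨j, hj⟩
  have hj' : ((z j : ℤ) : ℝ) ≠ 0 := by exact_mod_cast hj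
  have : 0 < ((z j : ℤ) : ℝ) ^ 2 := by positivity
  exact lt_of_lt_of_le this (Finset.single_le_sum (f := fun j => ((z j : ℤ) : ℝ) ^ 2)
    (fun _ _ => sq_nonneg _) (Finset.mem_univ j))

theorem ne_zero_of_S_pos {z : Site 4} (h : 0 < S z) : z ≠ 0 := by
  rintro rfl
  simp [S] at h

/-- **Far-field positivity of the parallel-plaquette curvature kernel in the transverse cone.**
There is `R₀ ≥ 1` such that for all sites `x, y` with `z = x − y` in the cone `4(z₁² + z₂²) ≤ |z|²`
and `|z| ≥ R₀`: `curvatureTwoPoint (x;1,2) (y;1,2) ≥ 1/(4π²|z|⁴)`. -/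
theorem kernel_cone_lower : ∃ R₀ : ℝ, 1 ≤ R₀ ∧ ∀ x y : Site 4,
    4 * ((((x - y) 1 : ℤ) : ℝ) ^ 2 + (((x - y) 2 : ℤ) : ℝ) ^ 2) ≤ S (x - y) → R₀ ^ 2 ≤ S (x - y) →
      1 / (4 * π ^ 2 * S (x - y) ^ 2) ≤ curvatureTwoPoint (x, P12) (y, P12) := by
  obtain ⟨K, hK0, hK⟩ := secondDiff_asymp
  refine ⟨4 * π ^ 2 * K + 1, by nlinarith [Real.pi_pos, mul_nonneg (sq_nonneg π) hK0], fun x y hcone hfar => ?_⟩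
  set z : Site 4 := x - y with hz
  have hR0pos : 0 < 4 * π ^ 2 * K + 1 := by positivity
  have hSpos : 0 < S z := lt_of_lt_of_le (by positivity) hfar
  have hz0 : z ≠ 0 := ne_zero_of_S_pos hSpos
  set s := S z with hs
  set r := Real.sqrt s with hr
  have hrpos : 0 < r := Real.sqrt_pos.mpr hSpos
  have hrR : 4 * π ^ 2 * K + 1 ≤ r := by
    have : Real.sqrt ((4 * π ^ 2 * K + 1) ^ 2) ≤ Real.sqrt s := Real.sqrt_le_sqrt hfar
    rwa [Real.sqrt_sq hR0pos.le] at this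
  have h1 := hK z hz0 1
  have h2 := hK z hz0 2
  rw [curvatureTwoPoint_P12, ← hz]
  set A1 := latticeGreen (z + Pi.single 1 1) + latticeGreen (z - Pi.single 1 1) - 2 * latticeGreen z with hA1
  set A2 := latticeGreen (z + Pi.single 2 1) + latticeGreen (z - Pi.single 2 1) - 2 * latticeGreen z with hA2
  set q : ℝ := ((z 1 : ℤ) : ℝ) ^ 2 + ((z 2 : ℤ) : ℝ) ^ 2 with hq
  -- the main term
  have hmain : 1 / (2 * π ^ 2 * s ^ 2) ≤
      (1 / π ^ 2 * (1 / s ^ 2 - 4 * ((z 1 : ℤ) : ℝ) ^ 2 / s ^ 3) +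
        1 / π ^ 2 * (1 / s ^ 2 - 4 * ((z 2 : ℤ) : ℝ) ^ 2 / s ^ 3)) / 2 := by
    have hq' : 4 * q ≤ s := hcone
    have e : (1 / π ^ 2 * (1 / s ^ 2 - 4 * ((z 1 : ℤ) : ℝ) ^ 2 / s ^ 3) +
        1 / π ^ 2 * (1 / s ^ 2 - 4 * ((z 2 : ℤ) : ℝ) ^ 2 / s ^ 3)) / 2 = 1 / π ^ 2 * (1 / s ^ 2 - 2 * q / s ^ 3) := by
      rw [hq]; ring
    rw [e]
    have hq2 : 2 * q / s ^ 3 ≤ 1 / (2 * s ^ 2) := by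
      rw [div_le_div_iff₀ (by positivity) (by positivity)]
      nlinarith [hSpos, sq_nonneg s]
    have hpi : 0 < 1 / π ^ 2 := by positivity
    have e2 : 1 / (2 * π ^ 2 * s ^ 2) = 1 / π ^ 2 * (1 / s ^ 2 - 1 / (2 * s ^ 2)) := by
      field_simp; ring
    rw [e2]
    exact mul_le_mul_of_nonneg_left (by linarith) hpi.le
  -- the error term
  have herr : K / (s ^ 2 * r) ≤ 1 / (4 * π ^ 2 * s ^ 2) := by
    rw [div_le_div_iff₀ (by positivity) (by positivity)]
    have : 4 * π ^ 2 * K ≤ r := by linarith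
    nlinarith [sq_nonneg s, hSpos]
  have e3 : 1 / (2 * π ^ 2 * s ^ 2) - 1 / (4 * π ^ 2 * s ^ 2) = 1 / (4 * π ^ 2 * s ^ 2) := by
    field_simp; ring
  have hb1 := (abs_le.mp h1).2
  have hb2 := (abs_le.mp h2).2
  linarith

theorem sq_le_of_abs_le {t B : ℝ} (h : |t| ≤ B) : t ^ 2 ≤ B ^ 2 :=
  sq_le_sq' (abs_le.mp h).1 (abs_le.mp h).2

/-! ## §6 The probe: a bump at `(ℓ/2)e₀`, the probe box around `X e₀`
(COPIED from `Cruxes/StaticSourceResponse/Lines/rung.lean` v3, seat ym-mirror-bc5w-1 g2; `cube L` = the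
crux's `box 4 L` here, the probe box renamed `pbox`) -/

section Bump

open Metric Set

/-- Centre of the probe at scale `ℓ`. -/
def ctr (ℓ : ℝ) : E4 := (ℓ / 2) • e₀

theorem ctr_apply (ℓ : ℝ) (k : Fin 4) : ctr ℓ k = if k = 0 then ℓ / 2 else 0 := by
  simp [ctr, e₀]

theorem abs_apply_le_norm (z : E4) (i : Fin 4) : |z i| ≤ ‖z‖ := by
  simpa [Real.norm_eq_abs] using PiLp.norm_apply_le z i

theorem norm_e₀ : ‖e₀‖ = 1 := by
  have h : ‖e₀‖ ^ 2 = 1 := by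
    rw [EuclideanSpace.real_norm_sq_eq]; simp [e₀]
  have h' : ‖e₀‖ ^ 2 = 1 ^ 2 := by rw [h, one_pow]
  exact (pow_left_inj₀ (norm_nonneg e₀) zero_le_one two_ne_zero).1 h'

theorem norm_ctr {ℓ : ℝ} (hℓ : 0 ≤ ℓ) : ‖ctr ℓ‖ = ℓ / 2 := by
  rw [ctr, norm_smul, norm_e₀, Real.norm_of_nonneg (by linarith), mul_one]

/-- The smooth bump at scale `ℓ`: `= 1` on `B̄(c_ℓ, ℓ/8)`, supported in `B̄(c_ℓ, ℓ/4)`. -/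
def bump (ℓ : ℝ) (hℓ : 0 < ℓ) : ContDiffBump (ctr ℓ) :=
  ⟨ℓ / 8, ℓ / 4, by positivity, by linarith⟩

@[simp] theorem bump_rIn (ℓ : ℝ) (hℓ : 0 < ℓ) : (bump ℓ hℓ).rIn = ℓ / 8 := rfl
@[simp] theorem bump_rOut (ℓ : ℝ) (hℓ : 0 < ℓ) : (bump ℓ hℓ).rOut = ℓ / 4 := rfl

/-- The probe as a Schwartz test function. -/
def wfun (ℓ : ℝ) (hℓ : 0 < ℓ) : SchwartzMap E4 ℝ :=
  (bump ℓ hℓ).hasCompactSupport.toSchwartzMap (bump ℓ hℓ).contDiff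

@[simp] theorem wfun_apply (ℓ : ℝ) (hℓ : 0 < ℓ) (x : E4) : wfun ℓ hℓ x = bump ℓ hℓ x := rfl

section Scale
variable {ℓ : ℝ} (hℓ : 0 < ℓ)

theorem time_lower_of_mem {x : E4} (hx : x ∈ closedBall (ctr ℓ) (ℓ / 4)) : ℓ / 4 ≤ x 0 := by
  rw [mem_closedBall, dist_eq_norm] at hx
  have h1 : |(x - ctr ℓ) 0| ≤ ‖x - ctr ℓ‖ := abs_apply_le_norm _ 0
  have h2 : (x - ctr ℓ) 0 = x 0 - ℓ / 2 := by simp [ctr_apply]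
  rw [h2] at h1
  have := (abs_le.mp (h1.trans hx)).1
  linarith

include hℓ in
theorem norm_le_of_mem {x : E4} (hx : x ∈ closedBall (ctr ℓ) (ℓ / 4)) : ‖x‖ ≤ 3 * ℓ / 4 := by
  rw [mem_closedBall, dist_eq_norm] at hx
  have hc : ‖ctr ℓ‖ = ℓ / 2 := norm_ctr hℓ.le
  calc ‖x‖ = ‖(x - ctr ℓ) + ctr ℓ‖ := by rw [sub_add_cancel]
    _ ≤ ‖x - ctr ℓ‖ + ‖ctr ℓ‖ := norm_add_le _ _
    _ ≤ ℓ / 4 + ℓ / 2 := add_le_add hx hc.le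
    _ = 3 * ℓ / 4 := by ring

theorem wfun_tsupport_pos : tsupport (wfun ℓ hℓ : E4 → ℝ) ⊆ {y | 0 < y 0} := by
  intro x hx
  change x ∈ tsupport (bump ℓ hℓ) at hx
  rw [(bump ℓ hℓ).tsupport_eq, bump_rOut] at hx
  have := time_lower_of_mem hx
  show 0 < x 0
  linarith

theorem wfun_tsupport_ball : tsupport (wfun ℓ hℓ : E4 → ℝ) ⊆ closedBall 0 ℓ := by
  intro x hx
  change x ∈ tsupport (bump ℓ hℓ) at hx
  rw [(bump ℓ hℓ).tsupport_eq, bump_rOut] at hx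
  rw [mem_closedBall, dist_zero_right]
  have := norm_le_of_mem hℓ hx
  linarith

theorem wfun_nonneg (z : E4) : 0 ≤ wfun ℓ hℓ z := (bump ℓ hℓ).nonneg' z

theorem wfun_le_one (z : E4) : wfun ℓ hℓ z ≤ 1 := (bump ℓ hℓ).le_one

theorem wfun_abs_le_one (z : E4) : |wfun ℓ hℓ z| ≤ 1 :=
  abs_le.2 ⟨by linarith [wfun_nonneg hℓ z], wfun_le_one hℓ z⟩

/-- the probe equals `1` at every point whose coordinates are within `ℓ/16` of the centre's. -/
theorem wfun_eq_one_of_coord {x : E4} (h0 : |x 0 - ℓ / 2| ≤ ℓ / 16) (hk : ∀ k : Fin 4, k ≠ 0 → |x k| ≤ ℓ / 16) :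
    wfun ℓ hℓ x = 1 := by
  rw [wfun_apply]
  apply (bump ℓ hℓ).one_of_mem_closedBall
  rw [mem_closedBall, dist_eq_norm, bump_rIn]
  have hsq : ‖x - ctr ℓ‖ ^ 2 ≤ (ℓ / 8) ^ 2 := by
    rw [EuclideanSpace.real_norm_sq_eq, Fin.sum_univ_four]
    have e0 : (x - ctr ℓ) 0 = x 0 - ℓ / 2 := by simp [ctr_apply]
    have e1 : (x - ctr ℓ) 1 = x 1 := by simp [ctr_apply]
    have e2 : (x - ctr ℓ) 2 = x 2 := by simp [ctr_apply]
    have e3 : (x - ctr ℓ) 3 = x 3 := by simp [ctr_apply]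
    rw [e0, e1, e2, e3]
    have s0 := sq_le_of_abs_le h0
    have s1 := sq_le_of_abs_le (hk 1 (by decide))
    have s2 := sq_le_of_abs_le (hk 2 (by decide))
    have s3 := sq_le_of_abs_le (hk 3 (by decide))
    nlinarith
  exact (pow_le_pow_iff_left₀ (norm_nonneg _) (by positivity) two_ne_zero).1 hsq

end Scale

/-! ### the probe box `X e₀ + [−N, N]⁴` -/

/-- centre `X e₀` of the probe box -/
def cy (X : ℕ) : Site 4 := fun k => if k = 0 then (X : ℤ) else 0

/-- the probe box `X e₀ + [−N, N]⁴` -/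
def pbox (X N : ℕ) : Finset (Site 4) :=
  Fintype.piFinset fun k => Finset.Icc (cy X k - N) (cy X k + N)

theorem mem_pbox {X N : ℕ} {y : Site 4} : y ∈ pbox X N ↔ ∀ k, cy X k - N ≤ y k ∧ y k ≤ cy X k + N := by
  simp [pbox, Fintype.mem_piFinset, Finset.mem_Icc]

theorem card_pbox (X N : ℕ) : (pbox X N).card = (2 * N + 1) ^ 4 := by
  rw [pbox, Fintype.card_piFinset]
  simp only [Int.card_Icc]
  have : ∀ k : Fin 4, (cy X k + ↑N + 1 - (cy X k - ↑N)).toNat = 2 * N + 1 := by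
    intro k
    have : cy X k + ↑N + 1 - (cy X k - ↑N) = ((2 * N + 1 : ℕ) : ℤ) := by push_cast; ring
    rw [this, Int.toNat_natCast]
  simp only [this, Finset.prod_const, Finset.card_univ, Fintype.card_fin]

theorem cy_apply_0 (X : ℕ) : cy X 0 = (X : ℤ) := by simp [cy]
theorem cy_apply_ne (X : ℕ) {k : Fin 4} (hk : k ≠ 0) : cy X k = 0 := by simp [cy, hk]

/-- real-coordinate bounds of a probe-box site -/
theorem pbox_bounds {X N : ℕ} {y : Site 4} (hy : y ∈ pbox X N) :
    |((y 0 : ℤ) : ℝ) - X| ≤ N ∧ |((y 1 : ℤ) : ℝ)| ≤ N ∧ |((y 2 : ℤ) : ℝ)| ≤ N ∧ |((y 3 : ℤ) : ℝ)| ≤ N := by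
  rw [mem_pbox] at hy
  have h0 := hy 0; have h1 := hy 1; have h2 := hy 2; have h3 := hy 3
  rw [cy_apply_0] at h0
  rw [cy_apply_ne X (by decide)] at h1 h2 h3
  refine ⟨?_, ?_, ?_, ?_⟩ <;> rw [abs_le] <;> constructor
  · have : ((X : ℤ) : ℝ) - N ≤ ((y 0 : ℤ) : ℝ) := by exact_mod_cast h0.1
    push_cast at this; linarith
  · have : ((y 0 : ℤ) : ℝ) ≤ ((X : ℤ) : ℝ) + N := by exact_mod_cast h0.2
    push_cast at this; linarith
  · have : ((0 : ℤ) : ℝ) - N ≤ ((y 1 : ℤ) : ℝ) := by exact_mod_cast h1.1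
    push_cast at this; linarith
  · have : ((y 1 : ℤ) : ℝ) ≤ ((0 : ℤ) : ℝ) + N := by exact_mod_cast h1.2
    push_cast at this; linarith
  · have : ((0 : ℤ) : ℝ) - N ≤ ((y 2 : ℤ) : ℝ) := by exact_mod_cast h2.1
    push_cast at this; linarith
  · have : ((y 2 : ℤ) : ℝ) ≤ ((0 : ℤ) : ℝ) + N := by exact_mod_cast h2.2
    push_cast at this; linarith
  · have : ((0 : ℤ) : ℝ) - N ≤ ((y 3 : ℤ) : ℝ) := by exact_mod_cast h3.1
    push_cast at this; linarith
  · have : ((y 3 : ℤ) : ℝ) ≤ ((0 : ℤ) : ℝ) + N := by exact_mod_cast h3.2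
    push_cast at this; linarith

theorem pbox_subset_box {X N L : ℕ} (h : X + N ≤ L) : pbox X N ⊆ box 4 L := by
  intro y hy
  rw [mem_pbox] at hy
  rw [Literature.Probability.LatticeModels.mem_box]
  intro k
  have hk := hy k
  by_cases hk0 : k = 0
  · subst hk0; rw [cy_apply_0] at hk; omega
  · rw [cy_apply_ne X hk0] at hk; omega

/-- the probe is `≡ 1` on the probe box once `aN ≤ ℓ/64` and `|aX − ℓ/2| ≤ ℓ/128` -/
theorem probe_one {ℓ : ℝ} (hℓ : 0 < ℓ) {a : ℝ} (ha : 0 ≤ a) {X N : ℕ} {y : Site 4} (hy : y ∈ pbox X N)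
    (haX : |a * X - ℓ / 2| ≤ ℓ / 128) (haN : a * N ≤ ℓ / 64) : wfun ℓ hℓ (a • siteToE y) = 1 := by
  obtain ⟨b0, b1, b2, b3⟩ := pbox_bounds hy
  apply wfun_eq_one_of_coord hℓ
  · simp only [PiLp.smul_apply, siteToE_apply, smul_eq_mul]
    have e : a * ((y 0 : ℤ) : ℝ) - ℓ / 2 = a * (((y 0 : ℤ) : ℝ) - X) + (a * X - ℓ / 2) := by ring
    rw [e]
    calc |a * (((y 0 : ℤ) : ℝ) - X) + (a * X - ℓ / 2)|
        ≤ |a * (((y 0 : ℤ) : ℝ) - X)| + |a * X - ℓ / 2| := abs_add_le _ _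
      _ ≤ a * N + ℓ / 128 := by
          refine add_le_add ?_ haX
          rw [abs_mul, abs_of_nonneg ha]
          exact mul_le_mul_of_nonneg_left b0 ha
      _ ≤ ℓ / 16 := by linarith
  · intro k hk
    simp only [PiLp.smul_apply, siteToE_apply, smul_eq_mul]
    rw [abs_mul, abs_of_nonneg ha]
    have hb : |((y k : ℤ) : ℝ)| ≤ N := by
      fin_cases k
      · exact absurd rfl hk
      · exact b1
      · exact b2
      · exact b3
    calc a * |((y k : ℤ) : ℝ)| ≤ a * N := mul_le_mul_of_nonneg_left hb ha
      _ ≤ ℓ / 16 := by linarith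

end Bump

/-! ## §7 The mirror geometry and the hyperscaling floor (NEW) -/

/-- The separation `z = ϑy − y'` between a probe-box site and the reflection of another
(`|y₀ − X|, |y₀' − X| ≤ N`, `|y_k|, |y_k'| ≤ N`, `32N ≤ X ≤ 64N`): transverse cone, far (`≥ N`), and not too far
(`|z|² ≤ 16912 N²`). -/
theorem geom2 {X N y0 y1 y2 y3 y0' y1' y2' y3' : ℝ} (hN : 1 ≤ N) (hX1 : 32 * N ≤ X) (hX2 : X ≤ 64 * N)
    (hy0 : |y0 - X| ≤ N) (hy1 : |y1| ≤ N) (hy2 : |y2| ≤ N) (hy3 : |y3| ≤ N)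
    (hy0' : |y0' - X| ≤ N) (hy1' : |y1'| ≤ N) (hy2' : |y2'| ≤ N) (hy3' : |y3'| ≤ N) :
    4 * ((y1 - y1') ^ 2 + (y2 - y2') ^ 2) ≤
        (-y0 - y0') ^ 2 + (y1 - y1') ^ 2 + (y2 - y2') ^ 2 + (y3 - y3') ^ 2 ∧
      N ^ 2 ≤ (-y0 - y0') ^ 2 + (y1 - y1') ^ 2 + (y2 - y2') ^ 2 + (y3 - y3') ^ 2 ∧
      (-y0 - y0') ^ 2 + (y1 - y1') ^ 2 + (y2 - y2') ^ 2 + (y3 - y3') ^ 2 ≤ 16912 * N ^ 2 := by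
  have h1 : |y1 - y1'| ≤ 2 * N := by
    rw [abs_le] at hy1 hy1' ⊢; constructor <;> linarith
  have h2 : |y2 - y2'| ≤ 2 * N := by
    rw [abs_le] at hy2 hy2' ⊢; constructor <;> linarith
  have h3 : |y3 - y3'| ≤ 2 * N := by
    rw [abs_le] at hy3 hy3' ⊢; constructor <;> linarith
  have h0u : |(-y0 - y0')| ≤ 130 * N := by
    rw [abs_le] at hy0 hy0' ⊢; constructor <;> linarith
  have h0l : 62 * N ≤ |(-y0 - y0')| := by
    rw [abs_le] at hy0 hy0'
    rw [le_abs]; right; linarith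
  have s1 := sq_le_of_abs_le h1
  have s2 := sq_le_of_abs_le h2
  have s3 := sq_le_of_abs_le h3
  have s0u := sq_le_of_abs_le h0u
  have s0l : (62 * N) ^ 2 ≤ (-y0 - y0') ^ 2 := by
    have := sq_le_sq' (by linarith [abs_nonneg (-y0 - y0')]) h0l
    rwa [sq_abs] at this
  refine ⟨by nlinarith, by nlinarith, by nlinarith⟩

/-- `|z|²` of the mirror separation `ϑy − y'` in coordinates -/
theorem S_tref_sub (y y' : Site 4) :
    S (tref y - y') = (-((y 0 : ℤ) : ℝ) - ((y' 0 : ℤ) : ℝ)) ^ 2 + (((y 1 : ℤ) : ℝ) - ((y' 1 : ℤ) : ℝ)) ^ 2 +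
      (((y 2 : ℤ) : ℝ) - ((y' 2 : ℤ) : ℝ)) ^ 2 + (((y 3 : ℤ) : ℝ) - ((y' 3 : ℤ) : ℝ)) ^ 2 := by
  rw [S_eq]
  simp only [Pi.sub_apply, tref_apply_zero, tref_apply_of_ne y (show (1 : Fin 4) ≠ 0 by decide),
    tref_apply_of_ne y (show (2 : Fin 4) ≠ 0 by decide), tref_apply_of_ne y (show (3 : Fin 4) ≠ 0 by decide)]
  push_cast
  ring

/-- **the uniform kernel floor between a probe-box site and the mirror image of another** -/
theorem kernel_lower_mirror {R₀ : ℝ}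
    (hker : ∀ x y : Site 4,
      4 * ((((x - y) 1 : ℤ) : ℝ) ^ 2 + (((x - y) 2 : ℤ) : ℝ) ^ 2) ≤ S (x - y) → R₀ ^ 2 ≤ S (x - y) →
        1 / (4 * π ^ 2 * S (x - y) ^ 2) ≤ curvatureTwoPoint (x, P12) (y, P12))
    {X N : ℕ} {y y' : Site 4} (hR0 : 0 ≤ R₀) (hN : (1 : ℝ) ≤ N) (hR : R₀ ≤ N) (hX1 : 32 * (N : ℝ) ≤ X)
    (hX2 : (X : ℝ) ≤ 64 * N) (hy : y ∈ pbox X N) (hy' : y' ∈ pbox X N) :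
    1 / (4 * π ^ 2 * (16912 * (N : ℝ) ^ 2) ^ 2) ≤ curvatureTwoPoint (tref y, P12) (y', P12) := by
  obtain ⟨b0, b1, b2, b3⟩ := pbox_bounds hy
  obtain ⟨b0', b1', b2', b3'⟩ := pbox_bounds hy'
  obtain ⟨gcone, gfar, gnear⟩ := geom2 hN hX1 hX2 b0 b1 b2 b3 b0' b1' b2' b3'
  have hS := S_tref_sub y y'
  have hz1 : (((tref y - y') 1 : ℤ) : ℝ) = ((y 1 : ℤ) : ℝ) - ((y' 1 : ℤ) : ℝ) := by
    simp only [Pi.sub_apply, tref_apply_of_ne y (show (1 : Fin 4) ≠ 0 by decide)]; push_cast; ring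
  have hz2 : (((tref y - y') 2 : ℤ) : ℝ) = ((y 2 : ℤ) : ℝ) - ((y' 2 : ℤ) : ℝ) := by
    simp only [Pi.sub_apply, tref_apply_of_ne y (show (2 : Fin 4) ≠ 0 by decide)]; push_cast; ring
  have h := hker (tref y) y' (by rw [hz1, hz2, hS]; exact gcone)
    (by rw [hS]; exact le_trans (by nlinarith [sq_nonneg (N - R₀)]) gfar)
  refine le_trans ?_ h
  have hSpos : 0 < S (tref y - y') := by rw [hS]; nlinarith
  apply one_div_le_one_div_of_le (by positivity)
  have : S (tref y - y') ≤ 16912 * (N : ℝ) ^ 2 := by rw [hS]; exact gnear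
  have h2 : S (tref y - y') ^ 2 ≤ (16912 * (N : ℝ) ^ 2) ^ 2 := pow_le_pow_left₀ hSpos.le this 2
  nlinarith [Real.pi_pos, sq_nonneg π]

/-- The floor constant of the lattice rung: `κL = 1/(8π⁴·16912⁴)` (spacing-free ⇒ `p = 0`). -/
def κL : ℝ := 1 / (8 * π ^ 4 * 16912 ^ 4)

theorem κL_pos : 0 < κL := by unfold κL; positivity

/-- **The hyperscaling mirror floor of the lattice Maxwell field**: for every window `ℓ` one bump probe `v`
(support in `{y₀ > 0} ∩ B̄(0, ℓ)`, `0 ≤ v ≤ 1`) and `a₀ > 0` such that for ALL spacings `0 < a ≤ a₀` and ALL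
cut-offs `L` with `ℓ ≤ aL`:  `κL ≤ MF a v L`. [this route] -/
theorem latticeMaxwell_mirrorFloor : ∀ ℓ : ℝ, 0 < ℓ → ∃ (v : SchwartzMap E4 ℝ) (a₀ : ℝ),
    tsupport (v : E4 → ℝ) ⊆ {y | 0 < y 0} ∧ tsupport (v : E4 → ℝ) ⊆ Metric.closedBall 0 ℓ ∧
    (∀ z, |v z| ≤ 1) ∧ (∀ z, 0 ≤ v z) ∧ 0 < a₀ ∧
    ∀ a : ℝ, 0 < a → a ≤ a₀ → ∀ L : ℕ, ℓ ≤ a * L → κL ≤ MF a (v : E4 → ℝ) L := by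
  intro ℓ hℓ
  obtain ⟨R₀, hR₀1, hker⟩ := kernel_cone_lower
  have hR₀0 : 0 ≤ R₀ := by linarith
  refine ⟨wfun ℓ hℓ, ℓ / (128 * R₀), wfun_tsupport_pos hℓ, wfun_tsupport_ball hℓ, wfun_abs_le_one hℓ,
    wfun_nonneg hℓ, by positivity, ?_⟩
  intro a ha ha₀ L hL
  -- the two lattice scales `N = ⌊ℓ/(64a)⌋`, `X = ⌊ℓ/(2a)⌋` (as in the sibling rung)
  set t : ℝ := ℓ / (64 * a) with ht
  have hat : a * t = ℓ / 64 := by rw [ht]; field_simp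
  have ht2 : 2 * R₀ ≤ t := by
    rw [ht, le_div_iff₀ (by positivity)]
    have : a * (128 * R₀) ≤ ℓ := by rwa [le_div_iff₀ (by positivity)] at ha₀
    linarith
  set N : ℕ := ⌊t⌋₊ with hN
  have htN : (N : ℝ) ≤ t := Nat.floor_le (by positivity)
  have htN' : t < N + 1 := Nat.lt_floor_add_one t
  have hN1 : (1 : ℝ) ≤ N := by linarith
  have hRN : R₀ ≤ N := by linarith
  set X : ℕ := ⌊ℓ / (2 * a)⌋₊ with hX
  have hX32t : ℓ / (2 * a) = 32 * t := by rw [ht]; field_simp; ring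
  have hXle : (X : ℝ) ≤ 32 * t := by rw [← hX32t]; exact Nat.floor_le (by positivity)
  have hXgt : 32 * t < X + 1 := by rw [← hX32t]; exact Nat.lt_floor_add_one _
  have hX1nat : 32 * N ≤ X := by
    have h : ((32 * N : ℕ) : ℝ) < X + 1 := by push_cast; linarith
    have h' : 32 * N < X + 1 := by exact_mod_cast h
    omega
  have hX1 : 32 * (N : ℝ) ≤ X := by exact_mod_cast hX1nat
  have hX2 : (X : ℝ) ≤ 64 * N := by linarith
  have haN : a * N ≤ ℓ / 64 := by rw [← hat]; exact mul_le_mul_of_nonneg_left htN ha.le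
  have haX : a * X ≤ ℓ / 2 := by
    have : a * X ≤ a * (32 * t) := mul_le_mul_of_nonneg_left hXle ha.le
    linarith [show a * (32 * t) = ℓ / 2 by rw [show a * (32 * t) = 32 * (a * t) by ring, hat]; ring]
  have haX' : ℓ / 2 - a < a * X := by
    have : a * (32 * t) < a * (X + 1) := mul_lt_mul_of_pos_left hXgt ha
    have e : a * (32 * t) = ℓ / 2 := by rw [show a * (32 * t) = 32 * (a * t) by ring, hat]; ring
    linarith
  have ha128 : a ≤ ℓ / 128 := by
    have : a * (128 * R₀) ≤ ℓ := by rwa [le_div_iff₀ (by positivity)] at ha₀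
    rw [le_div_iff₀ (by norm_num)]
    nlinarith
  have habsX : |a * X - ℓ / 2| ≤ ℓ / 128 := by
    rw [abs_le]; constructor <;> linarith
  -- the probe box sits inside the cut-off box
  have hsub : pbox X N ⊆ box 4 L := by
    apply pbox_subset_box
    have h1 : ((X : ℝ) + N) ≤ L := by
      have hLa : ℓ / a ≤ L := by rw [div_le_iff₀ ha]; linarith
      have : (X : ℝ) + N ≤ 33 * t := by linarith
      have e : ℓ / a = 64 * t := by rw [ht]; field_simp
      have : 33 * t ≤ 64 * t := by nlinarith
      linarith
    exact_mod_cast h1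
  -- the floor: keep only the probe-box pairs and the parallel `(1,2)` plaquettes
  set kmin : ℝ := 1 / (4 * π ^ 2 * (16912 * (N : ℝ) ^ 2) ^ 2) with hkmin
  have hkmin0 : 0 ≤ kmin := by positivity
  have hv0 : ∀ z, 0 ≤ (wfun ℓ hℓ : E4 → ℝ) z := wfun_nonneg hℓ
  have hterm : ∀ y ∈ pbox X N, ∀ y' ∈ pbox X N, 2 * kmin ^ 2 ≤ mterm a (wfun ℓ hℓ) y y' := by
    intro y hy y' hy'
    rw [mterm, probe_one hℓ ha.le hy habsX haN, probe_one hℓ ha.le hy' habsX haN, one_mul, one_mul]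
    refine le_trans ?_ (Finset.single_le_sum
      (fun q _ => Finset.sum_nonneg fun q' _ => by positivity) (mem_plaqAt y))
    refine le_trans ?_ (Finset.single_le_sum (f := fun q' => 2 * curvatureTwoPoint (reflPlaq (y, P12)) q' ^ 2)
      (fun q' _ => by positivity) (mem_plaqAt y'))
    rw [reflPlaq_P12]
    have hk := kernel_lower_mirror hker hR₀0 hN1 hRN hX1 hX2 hy hy'
    have hk2 : kmin ^ 2 ≤ curvatureTwoPoint (tref y, P12) (y', P12) ^ 2 := pow_le_pow_left₀ hkmin0 hk 2
    linarith
  have hinner : ∀ y ∈ pbox X N,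
      ((pbox X N).card : ℝ) * (2 * kmin ^ 2) ≤ ∑ y' ∈ pbox X N, mterm a (wfun ℓ hℓ) y y' := by
    intro y hy
    have h := Finset.card_nsmul_le_sum (pbox X N) (fun y' => mterm a (wfun ℓ hℓ) y y') (2 * kmin ^ 2)
      (fun y' hy' => hterm y hy y' hy')
    rwa [nsmul_eq_mul] at h
  have houter : ((pbox X N).card : ℝ) * (((pbox X N).card : ℝ) * (2 * kmin ^ 2)) ≤
      ∑ y ∈ pbox X N, ∑ y' ∈ pbox X N, mterm a (wfun ℓ hℓ) y y' := by
    have h := Finset.card_nsmul_le_sum (pbox X N) (fun y => ∑ y' ∈ pbox X N, mterm a (wfun ℓ hℓ) y y')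
      (((pbox X N).card : ℝ) * (2 * kmin ^ 2)) hinner
    rwa [nsmul_eq_mul] at h
  have hN0 : (0 : ℝ) < N := by linarith
  rw [MF_eq]
  calc κL = (N : ℝ) ^ 8 * (2 * kmin ^ 2) := by
        rw [κL, hkmin]; field_simp; ring
    _ ≤ (((pbox X N).card : ℝ) * ((pbox X N).card : ℝ)) * (2 * kmin ^ 2) := by
        apply mul_le_mul_of_nonneg_right _ (by positivity)
        rw [card_pbox]; push_cast
        have h1 : (N : ℝ) ≤ 2 * N + 1 := by linarith
        have h2 : (N : ℝ) ^ 8 ≤ (2 * N + 1) ^ 8 := pow_le_pow_left₀ hN0.le h1 8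
        calc (N : ℝ) ^ 8 ≤ (2 * N + 1) ^ 8 := h2
          _ = (2 * (N : ℝ) + 1) ^ 4 * (2 * (N : ℝ) + 1) ^ 4 := by ring
    _ = ((pbox X N).card : ℝ) * (((pbox X N).card : ℝ) * (2 * kmin ^ 2)) := by ring
    _ ≤ ∑ y ∈ pbox X N, ∑ y' ∈ pbox X N, mterm a (wfun ℓ hℓ) y y' := houter
    _ ≤ ∑ y ∈ pbox X N, ∑ y' ∈ box 4 L, mterm a (wfun ℓ hℓ) y y' :=
        Finset.sum_le_sum fun y _ =>
          Finset.sum_le_sum_of_subset_of_nonneg hsub fun y' _ _ => mterm_nonneg hv0 y y'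
    _ ≤ ∑ y ∈ box 4 L, ∑ y' ∈ box 4 L, mterm a (wfun ℓ hℓ) y y' :=
        Finset.sum_le_sum_of_subset_of_nonneg hsub fun y _ _ =>
          Finset.sum_nonneg fun y' _ => mterm_nonneg hv0 y y'

/-- **X₁'s block in the lattice Maxwell model, `J = 1`, `p = 0` (spacing-indexed form)**: verbatim the
`∃ J p κ, p < 8 ∧ 0 < κ ∧ ∀ ℓ₁ > 0, ∃ ℓ v …` block of `FiniteRankMirrorFloor` with the dictionary of the
module docstring (`torusE ↦ ∫·dμM`, `dens ↦ densA`, `cfgReflect ↦ cfgReflA`, `a β ↦ a`). [this route] -/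
theorem latticeMaxwell_finiteRankMirrorFloor :
    ∃ (J : ℕ) (p κ : ℝ), p < 8 ∧ 0 < κ ∧ ∀ ℓ₁ : ℝ, 0 < ℓ₁ →
      ∃ (ℓ : ℝ) (v : Fin J → SchwartzMap E4 ℝ) (a₀ Λ₅ : ℝ), 0 < ℓ ∧ ℓ < ℓ₁ ∧
        (∀ j, tsupport (v j : E4 → ℝ) ⊆ {y | 0 < y 0} ∧
          tsupport (v j : E4 → ℝ) ⊆ Metric.closedBall 0 ℓ ∧ ∀ z, |v j z| ≤ 1) ∧
        0 < a₀ ∧ ∀ a : ℝ, 0 < a → a ≤ a₀ → ∀ L : ℕ, Λ₅ ≤ a * L →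
          κ * ℓ ^ p ≤ ∑ j, ((∫ ω, probe a (v j) L (cfgReflA ω) * probe a (v j) L ω ∂μM)
            - (∫ ω, probe a (v j) L ω ∂μM) ^ 2) := by
  refine ⟨1, 0, κL, by norm_num, κL_pos, fun ℓ₁ hℓ₁ => ?_⟩
  obtain ⟨v, a₀, h1, h2, h3, _h4, ha₀, hfloor⟩ := latticeMaxwell_mirrorFloor (ℓ₁ / 2) (by positivity)
  refine ⟨ℓ₁ / 2, fun _ => v, a₀, ℓ₁ / 2, by positivity, by linarith, fun _ => ⟨h1, h2, h3⟩, ha₀,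
    fun a ha haa L hL => ?_⟩
  rw [Real.rpow_zero, mul_one, Fin.sum_univ_one]
  exact hfloor a ha haa L hL

/-- **X₁'s block in the lattice Maxwell model, literal scheme-indexed shape**: for EVERY positive scheme
`a β → 0` (the crux's `(∀ β, 0 < a β) ∧ Tendsto a atTop (nhds 0)`), the block
`∃ J p κ, p < 8 ∧ 0 < κ ∧ ∀ ℓ₁ > 0, ∃ ℓ v β₅ Λ₅, … ∀ β ≥ β₅, ∀ L, Λ₅ ≤ a β · L → κ ℓ^p ≤ ∑_j MF(a β, v_j, L)`
holds with `J = 1`, `p = 0`. [this route] -/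
theorem latticeMaxwell_finiteRankMirrorFloor_scheme (a : ℝ → ℝ) (ha : ∀ β, 0 < a β)
    (ha0 : Tendsto a atTop (nhds 0)) :
    ∃ (J : ℕ) (p κ : ℝ), p < 8 ∧ 0 < κ ∧ ∀ ℓ₁ : ℝ, 0 < ℓ₁ →
      ∃ (ℓ : ℝ) (v : Fin J → SchwartzMap E4 ℝ) (β₅ Λ₅ : ℝ), 0 < ℓ ∧ ℓ < ℓ₁ ∧
        (∀ j, tsupport (v j : E4 → ℝ) ⊆ {y | 0 < y 0} ∧
          tsupport (v j : E4 → ℝ) ⊆ Metric.closedBall 0 ℓ ∧ ∀ z, |v j z| ≤ 1) ∧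
        ∀ β : ℝ, β₅ ≤ β → ∀ L : ℕ, Λ₅ ≤ a β * L →
          κ * ℓ ^ p ≤ ∑ j, ((∫ ω, probe (a β) (v j) L (cfgReflA ω) * probe (a β) (v j) L ω ∂μM)
            - (∫ ω, probe (a β) (v j) L ω ∂μM) ^ 2) := by
  refine ⟨1, 0, κL, by norm_num, κL_pos, fun ℓ₁ hℓ₁ => ?_⟩
  obtain ⟨v, a₀, h1, h2, h3, _h4, ha₀, hfloor⟩ := latticeMaxwell_mirrorFloor (ℓ₁ / 2) (by positivity)
  obtain ⟨β₅, hβ₅⟩ := Filter.eventually_atTop.1 (ha0.eventually (eventually_lt_nhds ha₀))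
  refine ⟨ℓ₁ / 2, fun _ => v, β₅, ℓ₁ / 2, by positivity, by linarith, fun _ => ⟨h1, h2, h3⟩,
    fun β hβ L hL => ?_⟩
  rw [Real.rpow_zero, mul_one, Fin.sum_univ_one]
  exact hfloor (a β) (ha β) (hβ₅ β hβ).le L hL

/-! ## §8 (β): why a FORCED `J ≥ 2` instance is not exhibitable in a convergent model -/

/-- **Pigeonhole for modes**: at each `(a, L)`, a `J`-mode floor `κ ≤ ∑_j m_j` contains one mode with
`κ/J ≤ m_j`.  Hence a family can force `J ≥ 2` only if the index of that mode does not stabilise as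
`a → 0`, i.e. only if the single-mode functionals fail to converge while their sum stays `≥ κ` — impossible in
any model where `MF(a, v, L)` has a limit (in particular here, and at any scaling limit). [this route] -/
theorem exists_mode_of_sum_floor {J : ℕ} (hJ : 0 < J) (m : Fin J → ℝ) {κ : ℝ} (h : κ ≤ ∑ j, m j) :
    ∃ j, κ / J ≤ m j := by
  have hne : (Finset.univ : Finset (Fin J)).Nonempty := Finset.univ_nonempty_iff.2 ⟨⟨0, hJ⟩⟩
  have hJ' : (J : ℝ) ≠ 0 := by exact_mod_cast hJ.ne'
  have hs : ∑ _j : Fin J, κ / J = κ := by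
    rw [Finset.sum_const, Finset.card_univ, Fintype.card_fin, nsmul_eq_mul]
    field_simp
  obtain ⟨j, _, hj⟩ := Finset.exists_le_of_sum_le hne (f := fun _ => κ / J) (g := m) (by rw [hs]; exact h)
  exact ⟨j, hj⟩

/-- … and if the SAME mode `j` carries `κ/J` along the whole family, the floor already holds with `J = 1`
(and `κ/J`): the `∃ (modes per scale)` shape of X₁ cannot force `J ≥ 2` without index rotation. [this route] -/
theorem single_mode_of_stable_index {ι : Type*} {J : ℕ} (m : ι → Fin J → ℝ) {κ : ℝ} (j : Fin J)
    (h : ∀ i, κ / J ≤ m i j) : ∀ i, κ / J ≤ ∑ j' : Fin 1, m i ((fun _ => j) j') := by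
  intro i
  rw [Fin.sum_univ_one]
  exact h i

/-! ## §9 Separation: S's clause (ii) is FALSE in the free abelian model
(COPIED from `Cruxes/StaticSourceResponse/Lines/rung.lean`, Part A.3) -/

open scoped SchwartzMap in
open Summit.QuantumFields.YangMills.Theorems.SelfNormalisedSkewness.Negative in
/-- In the free Maxwell₄ model (tree `maxwellKernel`; the continuum limit of `μM`) the connected three-point
functional of the plaquette energy `F²` is `8·maxwellRing3 ≡ 0` (`maxwellRing3_eq_zero`), so NT's clause
(ii) floor admits no `ε > 0`: S's analogue is decided FALSE where X₁'s block is decided TRUE. [this route] -/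
theorem freeAbelian_NT_clauseII_false :
    ¬ ∃ (f g h : 𝓢(E4, ℝ)) (ε : ℝ), 0 < ε ∧ ε ≤ |8 * maxwellRing3 f g h| := by
  rintro ⟨f, g, h, ε, hε, hle⟩
  rw [maxwellRing3_eq_zero] at hle
  norm_num at hle
  linarith

open scoped SchwartzMap in
open Summit.QuantumFields.YangMills.Theorems.SelfNormalisedSkewness.Negative in
/-- **The lattice rung separates C from S**: X₁'s block holds in the abelian lattice gauge theory at Gaussian
coupling (honest measure, `J = 1`, `p = 0`) AND NT's clause (ii) fails in its free continuum limit. [this route] -/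
theorem latticeRung_separates :
    (∃ (J : ℕ) (p κ : ℝ), p < 8 ∧ 0 < κ ∧ ∀ ℓ₁ : ℝ, 0 < ℓ₁ →
      ∃ (ℓ : ℝ) (v : Fin J → SchwartzMap E4 ℝ) (a₀ Λ₅ : ℝ), 0 < ℓ ∧ ℓ < ℓ₁ ∧
        (∀ j, tsupport (v j : E4 → ℝ) ⊆ {y | 0 < y 0} ∧
          tsupport (v j : E4 → ℝ) ⊆ Metric.closedBall 0 ℓ ∧ ∀ z, |v j z| ≤ 1) ∧
        0 < a₀ ∧ ∀ a : ℝ, 0 < a → a ≤ a₀ → ∀ L : ℕ, Λ₅ ≤ a * L →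
          κ * ℓ ^ p ≤ ∑ j, ((∫ ω, probe a (v j) L (cfgReflA ω) * probe a (v j) L ω ∂μM)
            - (∫ ω, probe a (v j) L ω ∂μM) ^ 2)) ∧
    ¬ ∃ (f g h : 𝓢(E4, ℝ)) (ε : ℝ), 0 < ε ∧ ε ≤ |8 * maxwellRing3 f g h| :=
  ⟨latticeMaxwell_finiteRankMirrorFloor, freeAbelian_NT_clauseII_false⟩

end Summit.QuantumFields.YangMills.Cruxes.FiniteRankMirrorFloor.LatticeRung

end
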